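import Summits.ResolutionOfSingularities.ResolutionOfSingularities.Theorems.EquisingularLiftEquisingularLiftNatConeChart
import Summits.ResolutionOfSingularities.ResolutionOfSingularities.Theorems.EquisingularLiftEquisingularLiftNatCarrierDeltaFlat
import Literature.AlgebraicGeometry.Resolution.BlowupAlgebraStrictTransform
import HarnessLib

/-!
# [OURS · L1 W4.5(b) · EL♮(3)] T-M1-SCHEME part 2, ring core: THE CARRIER SUP — on the chart `A[I/x_j]`, the strict
# transform of `V(x₀) ∩ V(Φ(x′))` (a hypersurface INSIDE the regular carrier divisor `V(x₀)` through the centre) is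
# `V(x₀/x_j) ∩ V(Φ(e′))`: the sum `St(V(x₀)) + St(V(Φ))` of the two strict transforms IS saturated

Crux `EquisingularLiftNat` = stmt-ResolutionOfSingularities-20038 (child EL♮(3) = stmt-ResolutionOfSingularities-20148), route
EquisingularLift, line `sections`; registered stubs `stub_elnat_tcDeltaPointResolution` / `stub_elnat_three_isolated_nontc`
(skeleton v6, res-L1-w45b-lead-2), draft stub `stub_elnat_tcPlusPointResolution` (TARGET-TCPLUS, DESIGN v6/v7 (TC⁺)). Helper file
`--supports stmt-ResolutionOfSingularities-20148 --as helper` by res-L1-w45b-stub-1 (object T-M1-SCHEME part 2, STATUS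
2026-08-27T09:44Z). HONEST FRAMING: OURS (cell res-hironaka, slot W4.5(b)); NOT a statement of any manuscript; AI-written, weaker
than expert review. No `sorry`; standard axioms.

WHY. In DESIGN v6 (TC⁺) the centre is `St(D)`, `D = E ∩ V(K)` (`E` the regular carrier divisor through the section, `K` the
centred lift, of order `m` along the section INSIDE `E`); one WANTS the ideal sheaf `St(𝓘_E) ⊔ St(K)` (stalks: res-type-100's F2
p509910; special fibre: res-L1-w45b-stub-1's F⁺5 …NatStrictTransformComap) and NEEDS it to be SATURATED, i.e. `= St(D)`; downstairs
(over `k`) the same lemma identifies `St(𝓘_e) ⊔ St(K̄)` with the ideal of the strict transform of the tangent-cone curve `Z`.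

SETTING (any commutative ring `A`). `x = (x₀, x₁, …, x_r) : Fin (r+1) → A` with `x` quasi-regular and `A/I` a domain
(`I = (x)`, the SECTION); `x₀` = the equation of the CARRIER `S = V(x₀)` (regular, through the section); chart index `j = j′+1 ≠ 0`
(on the chart `j = 0` the carrier's strict transform is empty), `B = A[I/x_j]`, `t = x_j/1`, `e₀ = x₀/x_j`, `e′_l = x_{l+1}/x_j`;
`Φ ∈ A[T₁, …, T_r]` a FORM of degree `d` in the TAIL variables (the equation of `D` inside `S`, coefficients in `A`), with
`Φ mod I ≠ 0` — `D` has order EXACTLY `d` along the section inside `S` (equimultiplicity along the section); downstairs-in-the-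
carrier `A₀ = A/(x₀)`, `x̄′ = x′ mod x₀` quasi-regular (a HYPOTHESIS here; automatic for regular-sequence frames),
`θ₀ : B → A₀[Ī′/x̄_j′]` the reduction map (`blowupAlgebraMap` along `A → A₀`).

* `algebraMap_eval_tail_eq_pow_mul_aeval` (`Φ(x′)/1 = tᵈ·Φ(e′)`), `blowupAlgebraMap_carrier_aeval_tail` (`θ₀(Φ(e′)) = Φ̄(ē′)`),
  `blowupAlgebraMap_carrier_frac_zero` (`θ₀(e₀) = 0`), `prime_algebraMap_chart` / `not_dvd_frac_zero` (`t` prime in `B`, `t ∤ e₀`),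
  hence `ker_blowupAlgebraMap_carrier` — **`ker θ₀ = (e₀)`**: the chart of the blow-up of the carrier along the section IS `B/(e₀)`;
* **`mem_carrierSup_of_algebraMap_mul_mem`** — `t·y ∈ (e₀, Φ(e′)) ⇒ y ∈ (e₀, Φ(e′))`: modulo `e₀` this is …NatConeChart's
  `mem_span_coneTransform_of_algebraMap_mul_mem` over `A₀` (the equimultiplicity hypothesis transported along
  `(A/(x₀))/(x̄′) ≅ A/I`);
* **`iSup_colon_carrier_sup_eq`** — **`⋃ₙ ((x₀/1, Φ(x′)/1) : tⁿ) = (e₀) + (Φ(e′))`** in `B` (via the generic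
  `iSup_colon_span_singleton_pow_eq_of_le`): the strict transform of `D = V(x₀, Φ(x′))` on the chart is cut out by `e₀` and `Φ(e′)`
  — NO extra saturation; `…_localization`: the same in every localisation of `B` (F3a's `mem_map_of_mul_mem_localization`, p512232).

References: The Stacks Project, Tags 080C, 080D, 0BIQ; U. Görtz, T. Wedhorn, *Algebraic Geometry I* (2020), (13.19), Prop. 13.96
(2). Tree inputs: …NatConeChart (p508912), …NatCarrierDeltaFlat (p512232), `BlowupAlgebraStrictTransform`, `BlowupAlgebraQuasiRegularChart`.
-/

set_option linter.dupNamespace false -- mandated namespace `Summit.<Summit>.<Problem>` of this single-conjunct summit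

noncomputable section

namespace Summit.ResolutionOfSingularities.ResolutionOfSingularities.Cruxes.EquisingularLiftNat.Sections

open MvPolynomial IsLocalization Literature.AlgebraicGeometry.Resolution

universe u

/-! ## Generic: a saturated over-ideal within bounded `t`-distance is the saturation -/

section Generic

variable {S : Type*} [CommRing S]

/-- If `J ≤ T`, `T` is `t`-saturated (`t·y ∈ T ⇒ y ∈ T`) and `tᴺ·T ⊆ J`, then the `t`-saturation `⋃ₙ (J : tⁿ)` of `J` is `T`.
[folklore] -/
theorem iSup_colon_span_singleton_pow_eq_of_le {J T : Ideal S} {t : S} (hJT : J ≤ T)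
    (hsat : ∀ y : S, t * y ∈ T → y ∈ T) {N : ℕ} (hN : ∀ z ∈ T, t ^ N * z ∈ J) :
    ⨆ n : ℕ, Submodule.colon J ((Ideal.span {t} ^ n : Ideal S) : Set S) = T := by
  apply le_antisymm
  · refine iSup_le fun n => ?_
    intro y hy
    rw [mem_colon_span_singleton_pow_iff] at hy
    have hy' : t ^ n * y ∈ T := by rw [mul_comm]; exact hJT hy
    clear hy
    induction n with
    | zero => simpa using hy'
    | succ n ih =>
      apply ih
      apply hsat
      rw [← mul_assoc, ← pow_succ']
      exact hy'
  · intro z hz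
    refine Submodule.mem_iSup_of_mem N ?_
    rw [mem_colon_span_singleton_pow_iff, mul_comm]
    exact hN z hz

end Generic

/-! ## The chart `B = A[I/x_j]`, `j = j′ + 1`, of the blow-up along the section `I = (x₀, x′)` -/

section Chart

variable {A : Type u} [CommRing A] {r : ℕ} (x : Fin (r + 1) → A) (j' : Fin r)

/-- **`Φ(x′)/1 = tᵈ · Φ(e′)` on the chart** for a form `Φ` of degree `d` in the tail variables (`e′_l = x_{l+1}/x_j`): the cone
identity of …NatConeChart for `rename Fin.succ Φ`. [folklore] -/
theorem algebraMap_eval_tail_eq_pow_mul_aeval {d : ℕ} {Φ : MvPolynomial (Fin r) A} (hΦ : Φ.IsHomogeneous d) :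
    algebraMap A (blowupAlgebra (Ideal.span (Set.range x)) (x j'.succ)) (MvPolynomial.eval (fun l => x l.succ) Φ) =
      algebraMap A (blowupAlgebra (Ideal.span (Set.range x)) (x j'.succ)) (x j'.succ) ^ d *
        MvPolynomial.aeval (fun l => blowupAlgebra.frac x j'.succ l.succ) Φ := by
  have h := algebraMap_eval_eq_pow_mul_coneTransform x j'.succ (Φ := MvPolynomial.rename Fin.succ Φ) hΦ.rename_isHomogeneous
  rw [MvPolynomial.eval_rename, MvPolynomial.aeval_rename] at h
  exact h
/-! ### The reduction map `θ₀ : A[I/x_j] → A₀[Ī′/x̄_j′]` along `A → A₀ = A/(x₀)` -/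

/-- `I·A₀ ≤ Ī′ = (x̄′)`: the image of the section ideal in `A/(x₀)` is generated by the reductions of the tail. [folklore] -/
theorem map_span_range_le_span_range_tail :
    (Ideal.span (Set.range x)).map (Ideal.Quotient.mk (Ideal.span {x 0})) ≤
      Ideal.span (Set.range fun l : Fin r => Ideal.Quotient.mk (Ideal.span {x 0}) (x l.succ)) := by
  rw [Ideal.map_span, Ideal.span_le]
  rintro _ ⟨_, ⟨l, rfl⟩, rfl⟩
  refine Fin.cases ?_ (fun l => ?_) l
  · rw [Ideal.Quotient.eq_zero_iff_mem.mpr (Ideal.mem_span_singleton_self _)]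
    exact Ideal.zero_mem _
  · exact Ideal.subset_span ⟨l, rfl⟩

/-- `Ī′ ≤ I·A₀`. [folklore] -/
theorem span_range_tail_le_map_span_range :
    Ideal.span (Set.range fun l : Fin r => Ideal.Quotient.mk (Ideal.span {x 0}) (x l.succ)) ≤
      (Ideal.span (Set.range x)).map (Ideal.Quotient.mk (Ideal.span {x 0})) := by
  rw [Ideal.span_le]
  rintro _ ⟨l, rfl⟩
  exact Ideal.mem_map_of_mem _ (Ideal.subset_span ⟨l.succ, rfl⟩)

/-- `θ₀(a/1) = ā/1`. [folklore] -/
theorem blowupAlgebraMap_carrier_algebraMap (a : A) :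
    blowupAlgebraMap (Ideal.Quotient.mk (Ideal.span {x 0})) (Ideal.span (Set.range x))
        (Ideal.span (Set.range fun l : Fin r => Ideal.Quotient.mk (Ideal.span {x 0}) (x l.succ))) (x j'.succ)
        (map_span_range_le_span_range_tail x) (algebraMap A _ a) =
      algebraMap (A ⧸ Ideal.span {x 0}) _ (Ideal.Quotient.mk (Ideal.span {x 0}) a) :=
  blowupAlgebraMap_algebraMap _ _ _ _ _ a

/-- `θ₀(e′_l) = ē′_l`: the tail fractions reduce to the fractions of the reduced tail. [folklore] -/
theorem blowupAlgebraMap_carrier_frac_succ (l : Fin r) :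
    blowupAlgebraMap (Ideal.Quotient.mk (Ideal.span {x 0})) (Ideal.span (Set.range x))
        (Ideal.span (Set.range fun l : Fin r => Ideal.Quotient.mk (Ideal.span {x 0}) (x l.succ))) (x j'.succ)
        (map_span_range_le_span_range_tail x) (blowupAlgebra.frac x j'.succ l.succ) =
      blowupAlgebra.frac (fun l : Fin r => Ideal.Quotient.mk (Ideal.span {x 0}) (x l.succ)) j' l :=
  blowupAlgebraMap_gen _ _ _ _ _ (x l.succ) (blowupAlgebra.mem_span_range x l.succ)

/-- `θ₀(e₀) = 0`: the strict transform of the carrier dies in the carrier's own blow-up chart. [folklore] -/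
theorem blowupAlgebraMap_carrier_frac_zero :
    blowupAlgebraMap (Ideal.Quotient.mk (Ideal.span {x 0})) (Ideal.span (Set.range x))
        (Ideal.span (Set.range fun l : Fin r => Ideal.Quotient.mk (Ideal.span {x 0}) (x l.succ))) (x j'.succ)
        (map_span_range_le_span_range_tail x) (blowupAlgebra.frac x j'.succ 0) = 0 := by
  rw [blowupAlgebra.frac, blowupAlgebraMap_gen]
  apply Subtype.ext
  rw [blowupAlgebra.coe_gen, Ideal.Quotient.eq_zero_iff_mem.mpr (Ideal.mem_span_singleton_self _), map_zero, zero_mul]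
  rfl

/-- **`θ₀(Φ(e′)) = Φ̄(ē′)`** (`Φ̄ = Φ mod x₀`). [cite: GortzWedhorn2020, Prop. 13.96 (2) (proof), p. 416] -/
theorem blowupAlgebraMap_carrier_aeval_tail (Φ : MvPolynomial (Fin r) A) :
    blowupAlgebraMap (Ideal.Quotient.mk (Ideal.span {x 0})) (Ideal.span (Set.range x))
        (Ideal.span (Set.range fun l : Fin r => Ideal.Quotient.mk (Ideal.span {x 0}) (x l.succ))) (x j'.succ)
        (map_span_range_le_span_range_tail x) (MvPolynomial.aeval (fun l => blowupAlgebra.frac x j'.succ l.succ) Φ) =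
      MvPolynomial.aeval (blowupAlgebra.frac (fun l : Fin r => Ideal.Quotient.mk (Ideal.span {x 0}) (x l.succ)) j')
        (MvPolynomial.map (Ideal.Quotient.mk (Ideal.span {x 0})) Φ) := by
  induction Φ using MvPolynomial.induction_on with
  | C a => rw [MvPolynomial.map_C, MvPolynomial.algHom_C, MvPolynomial.algHom_C, blowupAlgebraMap_carrier_algebraMap]
  | add p q hp hq => simp only [map_add, hp, hq]
  | mul_X p l hp => simp only [map_mul, hp, MvPolynomial.map_X, MvPolynomial.aeval_X, blowupAlgebraMap_carrier_frac_succ]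

/-! ### `t` is a prime element of the chart not dividing `e₀`; `ker θ₀ = (e₀)` -/

/-- For `x` quasi-regular with `A/I` a domain, the exceptional equation `t = xᵢ/1` is a PRIME element of the chart `A[I/xᵢ]`
(`A[I/xᵢ]/(t) ≅ (A/I)[T_l : l ≠ i]` is a domain, Stacks 0BIQ; `t` is a nonzerodivisor of a non-trivial ring, hence non-zero).
[cite: StacksProject, Tag 0BIQ] -/
theorem prime_algebraMap_chart (hx : IsQuasiRegular x) [IsDomain (A ⧸ Ideal.span (Set.range x))] (i : Fin (r + 1)) :
    Prime (algebraMap A (blowupAlgebra (Ideal.span (Set.range x)) (x i)) (x i)) := by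
  haveI hdom : IsDomain (blowupAlgebra (Ideal.span (Set.range x)) (x i) ⧸
      Ideal.span {algebraMap A (blowupAlgebra (Ideal.span (Set.range x)) (x i)) (x i)}) :=
    MulEquiv.isDomain (MvPolynomial {l : Fin (r + 1) // l ≠ i} (A ⧸ Ideal.span (Set.range x)))
      (blowupAlgebraQuotEquiv x i hx).symm.toMulEquiv
  haveI : Nontrivial (blowupAlgebra (Ideal.span (Set.range x)) (x i)) :=
    RingHom.domain_nontrivial (Ideal.Quotient.mk
      (Ideal.span {algebraMap A (blowupAlgebra (Ideal.span (Set.range x)) (x i)) (x i)}))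
  have ht0 : algebraMap A (blowupAlgebra (Ideal.span (Set.range x)) (x i)) (x i) ≠ 0 :=
    nonZeroDivisors.ne_zero algebraMap_mem_nonZeroDivisors_blowupAlgebra
  exact (Ideal.span_singleton_prime ht0).mp ((Ideal.Quotient.isDomain_iff_prime _).mp hdom)

/-- `t ∤ e₀ = x₀/x_j` (`j = j′+1 ≠ 0`): modulo `t` the fraction `e₀` is the VARIABLE `T₀` of `(A/I)[T_l : l ≠ j]`. [folklore] -/
theorem not_dvd_frac_zero (hx : IsQuasiRegular x) [IsDomain (A ⧸ Ideal.span (Set.range x))] :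
    ¬ algebraMap A (blowupAlgebra (Ideal.span (Set.range x)) (x j'.succ)) (x j'.succ) ∣ blowupAlgebra.frac x j'.succ 0 := by
  intro hdvd
  have h0 : Ideal.Quotient.mk (Ideal.span {algebraMap A (blowupAlgebra (Ideal.span (Set.range x)) (x j'.succ)) (x j'.succ)})
      (blowupAlgebra.frac x j'.succ 0) = 0 :=
    Ideal.Quotient.eq_zero_iff_mem.mpr (Ideal.mem_span_singleton.mpr hdvd)
  have hX : blowupAlgebraQuotEquiv x j'.succ hx (MvPolynomial.X ⟨0, (Fin.succ_ne_zero j').symm⟩) =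
      Ideal.Quotient.mk _ (blowupAlgebra.frac x j'.succ 0) :=
    blowupAlgebraQuotEquiv_X x j'.succ hx ⟨0, (Fin.succ_ne_zero j').symm⟩
  rw [h0] at hX
  exact MvPolynomial.X_ne_zero _ ((blowupAlgebraQuotEquiv x j'.succ hx).injective (hX.trans (map_zero _).symm))

/-- **`ker θ₀ = (e₀)`**: the kernel of the reduction map `A[I/x_j] → (A/x₀)[Ī′/x̄_j′]` is generated by the strict transform
`e₀ = x₀/x_j` of the carrier's equation — the chart of the blow-up of the regular carrier `S = V(x₀)` along the section IS
`A[I/x_j]/(e₀)`. [cite: GortzWedhorn2020, Prop. 13.96 (2) and p. 416] -/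
theorem ker_blowupAlgebraMap_carrier (hx : IsQuasiRegular x) [IsDomain (A ⧸ Ideal.span (Set.range x))] :
    RingHom.ker (blowupAlgebraMap (Ideal.Quotient.mk (Ideal.span {x 0})) (Ideal.span (Set.range x))
        (Ideal.span (Set.range fun l : Fin r => Ideal.Quotient.mk (Ideal.span {x 0}) (x l.succ))) (x j'.succ)
        (map_span_range_le_span_range_tail x)) =
      Ideal.span {blowupAlgebra.frac x j'.succ 0} := by
  refine ker_blowupAlgebraMap_eq_span (Ideal.Quotient.mk (Ideal.span {x 0}))
    (Ideal.span (Set.range fun l : Fin r => Ideal.Quotient.mk (Ideal.span {x 0}) (x l.succ)))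
    (map_span_range_le_span_range_tail x) Ideal.mk_ker (n := 1) ?_ (prime_algebraMap_chart x hx j'.succ)
    (not_dvd_frac_zero x j' hx)
  rw [pow_one, blowupAlgebra.frac, blowupAlgebra.algebraMap_mul_gen]

/-- `θ₀` is surjective. [folklore] -/
theorem blowupAlgebraMap_carrier_surjective :
    Function.Surjective (blowupAlgebraMap (Ideal.Quotient.mk (Ideal.span {x 0})) (Ideal.span (Set.range x))
        (Ideal.span (Set.range fun l : Fin r => Ideal.Quotient.mk (Ideal.span {x 0}) (x l.succ))) (x j'.succ)
        (map_span_range_le_span_range_tail x)) :=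
  blowupAlgebraMap_surjective _ _ _ _ Ideal.Quotient.mk_surjective _ (span_range_tail_le_map_span_range x)

/-! ### Transport of the equimultiplicity hypothesis along `(A/(x₀))/(x̄′) ≅ A/I` -/

/-- `(A/(x₀))/(x̄′) ≅ A/(x)`, compatibly with the quotient maps. [folklore] -/
theorem exists_quotQuot_tail_equiv :
    ∃ ε : ((A ⧸ Ideal.span {x 0}) ⧸ Ideal.span (Set.range fun l : Fin r => Ideal.Quotient.mk (Ideal.span {x 0}) (x l.succ))) ≃+*
        (A ⧸ Ideal.span (Set.range x)),
      ∀ a, ε (Ideal.Quotient.mk _ (Ideal.Quotient.mk _ a)) = Ideal.Quotient.mk _ a := by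
  have hJ : (Ideal.span (Set.range fun l : Fin r => x l.succ)).map (Ideal.Quotient.mk (Ideal.span {x 0})) =
      Ideal.span (Set.range fun l : Fin r => Ideal.Quotient.mk (Ideal.span {x 0}) (x l.succ)) := by
    rw [Ideal.map_span, ← Set.range_comp]
    rfl
  have hsup : Ideal.span {x 0} ⊔ Ideal.span (Set.range fun l : Fin r => x l.succ) = Ideal.span (Set.range x) := by
    rw [← Ideal.span_union, Fin.range_fin_succ x, Set.singleton_union]
    rfl
  refine ⟨((Ideal.quotEquivOfEq hJ.symm).trans (DoubleQuot.quotQuotEquivQuotSup _ _)).trans (Ideal.quotEquivOfEq hsup),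
    fun a => ?_⟩
  rfl

/-- The reduced tail form is non-zero when the reduced form is: `Φ mod I ≠ 0 ⇒ (Φ mod x₀)(T_j′ := 1) mod (x̄′) ≠ 0` (for a FORM
`Φ`; dehomogenisation is injective on forms). [folklore] -/
theorem map_dehomogenize_tail_ne_zero {d : ℕ} {Φ : MvPolynomial (Fin r) A} (hΦd : Φ.IsHomogeneous d)
    (hΦ : MvPolynomial.map (Ideal.Quotient.mk (Ideal.span (Set.range x))) Φ ≠ 0) :
    MvPolynomial.map (Ideal.Quotient.mk (Ideal.span (Set.range fun l : Fin r => Ideal.Quotient.mk (Ideal.span {x 0}) (x l.succ))))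
        (dehomogenize j' (MvPolynomial.map (Ideal.Quotient.mk (Ideal.span {x 0})) Φ)) ≠ 0 := by
  classical
  obtain ⟨ε, hε⟩ := exists_quotQuot_tail_equiv x
  intro h0
  apply dehomogenize_ne_zero_of_isHomogeneous j' (hΦd.map (Ideal.Quotient.mk (Ideal.span (Set.range x)))) hΦ
  rw [← map_dehomogenize]
  have hcomp : (ε.toRingHom.comp ((Ideal.Quotient.mk _).comp (Ideal.Quotient.mk (Ideal.span {x 0})))) =
      Ideal.Quotient.mk (Ideal.span (Set.range x)) := RingHom.ext fun a => hε a
  rw [← hcomp, ← MvPolynomial.map_map, ← MvPolynomial.map_map, map_dehomogenize, map_dehomogenize, ← map_dehomogenize, h0,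
    map_zero]

/-- `(A/(x₀))/(x̄′)` is a domain when `A/I` is. [folklore] -/
theorem isDomain_quotQuot_tail [IsDomain (A ⧸ Ideal.span (Set.range x))] :
    IsDomain ((A ⧸ Ideal.span {x 0}) ⧸ Ideal.span (Set.range fun l : Fin r => Ideal.Quotient.mk (Ideal.span {x 0}) (x l.succ))) := by
  obtain ⟨ε, -⟩ := exists_quotQuot_tail_equiv x
  exact MulEquiv.isDomain _ ε.toMulEquiv

/-! ### The carrier sup is saturated -/

/-- **`t` is a nonzerodivisor modulo `(e₀, Φ(e′))`.** `x` quasi-regular, `A/I` a domain, `x̄′ = x′ mod x₀` quasi-regular in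
`A/(x₀)`, `Φ` a form of degree `d` in the tail variables with `Φ mod I ≠ 0`: then `t·y ∈ (e₀) + (Φ(e′)) ⇒ y ∈ (e₀) + (Φ(e′))`
on `A[I/x_j]` (`j = j′+1`). Modulo `e₀`, i.e. on the chart `(A/x₀)[Ī′/x̄_j′]` of the blow-up of the carrier, this is
…NatConeChart's `mem_span_coneTransform_of_algebraMap_mul_mem`. [cite: StacksProject, Tag 080C]
[OURS · L1 W4.5b] T-M1-SCHEME part 2 toward `stub_elnat_three_isolated_nontc` / `stub_elnat_tcPlusPointResolution`; NOT a
statement of the manuscript. -/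
theorem mem_carrierSup_of_algebraMap_mul_mem (hx : IsQuasiRegular x) [IsDomain (A ⧸ Ideal.span (Set.range x))]
    (hxb : IsQuasiRegular fun l : Fin r => Ideal.Quotient.mk (Ideal.span {x 0}) (x l.succ))
    {d : ℕ} {Φ : MvPolynomial (Fin r) A} (hΦd : Φ.IsHomogeneous d)
    (hΦ : MvPolynomial.map (Ideal.Quotient.mk (Ideal.span (Set.range x))) Φ ≠ 0)
    (y : blowupAlgebra (Ideal.span (Set.range x)) (x j'.succ))
    (hy : algebraMap A (blowupAlgebra (Ideal.span (Set.range x)) (x j'.succ)) (x j'.succ) * y ∈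
      Ideal.span {blowupAlgebra.frac x j'.succ 0} ⊔
        Ideal.span {MvPolynomial.aeval (fun l => blowupAlgebra.frac x j'.succ l.succ) Φ}) :
    y ∈ Ideal.span {blowupAlgebra.frac x j'.succ 0} ⊔
      Ideal.span {MvPolynomial.aeval (fun l => blowupAlgebra.frac x j'.succ l.succ) Φ} := by
  classical
  set θ₀ := blowupAlgebraMap (Ideal.Quotient.mk (Ideal.span {x 0})) (Ideal.span (Set.range x))
    (Ideal.span (Set.range fun l : Fin r => Ideal.Quotient.mk (Ideal.span {x 0}) (x l.succ))) (x j'.succ)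
    (map_span_range_le_span_range_tail x) with hθ₀
  set T := Ideal.span {blowupAlgebra.frac x j'.succ 0} ⊔
    Ideal.span {MvPolynomial.aeval (fun l => blowupAlgebra.frac x j'.succ l.succ) Φ} with hT
  haveI := isDomain_quotQuot_tail x
  -- the image of `T` under `θ₀` is the principal ideal of the reduced cone transform
  have hTmap : T.map θ₀ = Ideal.span {MvPolynomial.aeval
      (blowupAlgebra.frac (fun l : Fin r => Ideal.Quotient.mk (Ideal.span {x 0}) (x l.succ)) j')
      (MvPolynomial.map (Ideal.Quotient.mk (Ideal.span {x 0})) Φ)} := by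
    rw [hT, Ideal.map_sup, Ideal.map_span, Ideal.map_span, Set.image_singleton, Set.image_singleton, hθ₀,
      blowupAlgebraMap_carrier_frac_zero, blowupAlgebraMap_carrier_aeval_tail, Ideal.span_singleton_zero, bot_sup_eq]
  -- apply `θ₀` to the membership and use the cone lemma downstairs-in-the-carrier
  have hθy : θ₀ (algebraMap A _ (x j'.succ)) * θ₀ y ∈ T.map θ₀ := by
    rw [← map_mul]
    exact Ideal.mem_map_of_mem _ hy
  rw [hTmap, hθ₀, blowupAlgebraMap_carrier_algebraMap] at hθy
  have hcone := mem_span_coneTransform_of_algebraMap_mul_mem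
    (fun l : Fin r => Ideal.Quotient.mk (Ideal.span {x 0}) (x l.succ)) j' hxb
    (map_dehomogenize_tail_ne_zero x j' hΦd hΦ) (θ₀ y) hθy
  -- pull back along the surjection `θ₀` with kernel `(e₀) ≤ T`
  have hmem : y ∈ (T.map θ₀).comap θ₀ := by
    rw [Ideal.mem_comap, hTmap]
    exact hcone
  rw [Ideal.comap_map_of_surjective _ (blowupAlgebraMap_carrier_surjective x j'), ← RingHom.ker_eq_comap_bot,
    ker_blowupAlgebraMap_carrier x j' hx] at hmem
  have hle : T ⊔ Ideal.span {blowupAlgebra.frac x j'.succ 0} ≤ T := sup_le le_rfl (by rw [hT]; exact le_sup_left)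
  exact hle hmem

/-- **THE CARRIER SUP IS THE STRICT TRANSFORM.** Under the hypotheses of `mem_carrierSup_of_algebraMap_mul_mem`:
`⋃ₙ ((x₀/1, Φ(x′)/1) : tⁿ) = (x₀/x_j) + (Φ(e′))` in `A[I/x_j]` — on the chart `j = j′+1`, the strict transform of the
in-carrier hypersurface `D = V(x₀) ∩ V(Φ(x′))` (the saturation of its total transform by the exceptional equation) is cut out
by the strict transform `e₀` of the carrier and the strict transform `Φ(e′)` of the hypersurface, with NO further saturation.
[cite: StacksProject, Tag 080C] [cite: GortzWedhorn2020, (13.19) p. 414] [OURS · L1 W4.5b] T-M1-SCHEME part 2; NOT a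
statement of the manuscript. -/
theorem iSup_colon_carrier_sup_eq (hx : IsQuasiRegular x) [IsDomain (A ⧸ Ideal.span (Set.range x))]
    (hxb : IsQuasiRegular fun l : Fin r => Ideal.Quotient.mk (Ideal.span {x 0}) (x l.succ))
    {d : ℕ} {Φ : MvPolynomial (Fin r) A} (hΦd : Φ.IsHomogeneous d)
    (hΦ : MvPolynomial.map (Ideal.Quotient.mk (Ideal.span (Set.range x))) Φ ≠ 0) :
    ⨆ n : ℕ, Submodule.colon
        (Ideal.span {algebraMap A (blowupAlgebra (Ideal.span (Set.range x)) (x j'.succ)) (x 0)} ⊔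
          Ideal.span {algebraMap A (blowupAlgebra (Ideal.span (Set.range x)) (x j'.succ))
            (MvPolynomial.eval (fun l => x l.succ) Φ)})
        ((Ideal.span {algebraMap A (blowupAlgebra (Ideal.span (Set.range x)) (x j'.succ)) (x j'.succ)} ^ n :
          Ideal (blowupAlgebra (Ideal.span (Set.range x)) (x j'.succ))) : Set _) =
      Ideal.span {blowupAlgebra.frac x j'.succ 0} ⊔
        Ideal.span {MvPolynomial.aeval (fun l => blowupAlgebra.frac x j'.succ l.succ) Φ} := by
  set t := algebraMap A (blowupAlgebra (Ideal.span (Set.range x)) (x j'.succ)) (x j'.succ) with ht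
  have h0 : algebraMap A (blowupAlgebra (Ideal.span (Set.range x)) (x j'.succ)) (x 0) = t * blowupAlgebra.frac x j'.succ 0 := by
    rw [ht, blowupAlgebra.frac, blowupAlgebra.algebraMap_mul_gen]
  have hG := algebraMap_eval_tail_eq_pow_mul_aeval x j' hΦd
  refine iSup_colon_span_singleton_pow_eq_of_le ?_ (mem_carrierSup_of_algebraMap_mul_mem x j' hx hxb hΦd hΦ) (N := d + 1) ?_
  · refine sup_le ?_ ?_
    · rw [Ideal.span_singleton_le_iff_mem, h0]
      exact Ideal.mem_sup_left (Ideal.mul_mem_left _ _ (Ideal.mem_span_singleton_self _))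
    · rw [Ideal.span_singleton_le_iff_mem, hG]
      exact Ideal.mem_sup_right (Ideal.mul_mem_left _ _ (Ideal.mem_span_singleton_self _))
  · intro z hz
    obtain ⟨u, hu, v, hv, rfl⟩ := Submodule.mem_sup.mp hz
    obtain ⟨a, rfl⟩ := Ideal.mem_span_singleton'.mp hu
    obtain ⟨b, rfl⟩ := Ideal.mem_span_singleton'.mp hv
    rw [mul_add]
    refine Ideal.add_mem _ (Ideal.mem_sup_left ?_) (Ideal.mem_sup_right ?_)
    · rw [show t ^ (d + 1) * (a * blowupAlgebra.frac x j'.succ 0) = (a * t ^ d) * (t * blowupAlgebra.frac x j'.succ 0) by ring,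
        ← h0]
      exact Ideal.mul_mem_left _ _ (Ideal.mem_span_singleton_self _)
    · rw [show t ^ (d + 1) * (b * MvPolynomial.aeval (fun l => blowupAlgebra.frac x j'.succ l.succ) Φ) =
          (b * t) * (t ^ d * MvPolynomial.aeval (fun l => blowupAlgebra.frac x j'.succ l.succ) Φ) by ring, ← hG]
      exact Ideal.mul_mem_left _ _ (Ideal.mem_span_singleton_self _)

/-- **The carrier sup in stalk currency**: in every localisation `S` of the chart (the local rings of the blow-up at the points
of `D₊(x_j)`), `t·y ∈ (e₀, Φ(e′))S ⇒ y ∈ (e₀, Φ(e′))S` and `⋃ₙ ((x₀/1, Φ(x′)/1)S : tⁿ) = (e₀, Φ(e′))S`.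
[cite: StacksProject, Tag 080C] [OURS · L1 W4.5b] T-M1-SCHEME part 2; NOT a statement of the manuscript. -/
theorem iSup_colon_carrier_sup_eq_localization (hx : IsQuasiRegular x) [IsDomain (A ⧸ Ideal.span (Set.range x))]
    (hxb : IsQuasiRegular fun l : Fin r => Ideal.Quotient.mk (Ideal.span {x 0}) (x l.succ))
    {d : ℕ} {Φ : MvPolynomial (Fin r) A} (hΦd : Φ.IsHomogeneous d)
    (hΦ : MvPolynomial.map (Ideal.Quotient.mk (Ideal.span (Set.range x))) Φ ≠ 0)
    (M : Submonoid (blowupAlgebra (Ideal.span (Set.range x)) (x j'.succ))) (S : Type*) [CommRing S]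
    [Algebra (blowupAlgebra (Ideal.span (Set.range x)) (x j'.succ)) S] [IsLocalization M S] :
    (∀ y : S, algebraMap _ S (algebraMap A (blowupAlgebra (Ideal.span (Set.range x)) (x j'.succ)) (x j'.succ)) * y ∈
        (Ideal.span {blowupAlgebra.frac x j'.succ 0} ⊔
          Ideal.span {MvPolynomial.aeval (fun l => blowupAlgebra.frac x j'.succ l.succ) Φ}).map (algebraMap _ S) →
      y ∈ (Ideal.span {blowupAlgebra.frac x j'.succ 0} ⊔
          Ideal.span {MvPolynomial.aeval (fun l => blowupAlgebra.frac x j'.succ l.succ) Φ}).map (algebraMap _ S)) ∧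
    ⨆ n : ℕ, Submodule.colon
        ((Ideal.span {algebraMap A (blowupAlgebra (Ideal.span (Set.range x)) (x j'.succ)) (x 0)} ⊔
          Ideal.span {algebraMap A (blowupAlgebra (Ideal.span (Set.range x)) (x j'.succ))
            (MvPolynomial.eval (fun l => x l.succ) Φ)}).map (algebraMap _ S))
        ((Ideal.span {algebraMap _ S (algebraMap A (blowupAlgebra (Ideal.span (Set.range x)) (x j'.succ)) (x j'.succ))} ^ n :
          Ideal S) : Set S) =
      (Ideal.span {blowupAlgebra.frac x j'.succ 0} ⊔
          Ideal.span {MvPolynomial.aeval (fun l => blowupAlgebra.frac x j'.succ l.succ) Φ}).map (algebraMap _ S) := by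
  have hsat : ∀ y : S, algebraMap _ S (algebraMap A (blowupAlgebra (Ideal.span (Set.range x)) (x j'.succ)) (x j'.succ)) * y ∈
      (Ideal.span {blowupAlgebra.frac x j'.succ 0} ⊔
        Ideal.span {MvPolynomial.aeval (fun l => blowupAlgebra.frac x j'.succ l.succ) Φ}).map (algebraMap _ S) →
      y ∈ (Ideal.span {blowupAlgebra.frac x j'.succ 0} ⊔
        Ideal.span {MvPolynomial.aeval (fun l => blowupAlgebra.frac x j'.succ l.succ) Φ}).map (algebraMap _ S) :=
    fun y hy => mem_map_of_mul_mem_localization M S (mem_carrierSup_of_algebraMap_mul_mem x j' hx hxb hΦd hΦ) y hy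
  refine ⟨hsat, ?_⟩
  set t := algebraMap A (blowupAlgebra (Ideal.span (Set.range x)) (x j'.succ)) (x j'.succ) with ht
  have h0 : algebraMap A (blowupAlgebra (Ideal.span (Set.range x)) (x j'.succ)) (x 0) = t * blowupAlgebra.frac x j'.succ 0 := by
    rw [ht, blowupAlgebra.frac, blowupAlgebra.algebraMap_mul_gen]
  have hG := algebraMap_eval_tail_eq_pow_mul_aeval x j' hΦd
  refine iSup_colon_span_singleton_pow_eq_of_le (Ideal.map_mono ?_) hsat (N := d + 1) ?_
  · refine sup_le ?_ ?_
    · rw [Ideal.span_singleton_le_iff_mem, h0]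
      exact Ideal.mem_sup_left (Ideal.mul_mem_left _ _ (Ideal.mem_span_singleton_self _))
    · rw [Ideal.span_singleton_le_iff_mem, hG]
      exact Ideal.mem_sup_right (Ideal.mul_mem_left _ _ (Ideal.mem_span_singleton_self _))
  · intro z hz
    rw [Ideal.map_sup, Ideal.map_span, Ideal.map_span, Set.image_singleton, Set.image_singleton] at hz ⊢
    obtain ⟨u, hu, v, hv, rfl⟩ := Submodule.mem_sup.mp hz
    obtain ⟨a, rfl⟩ := Ideal.mem_span_singleton'.mp hu
    obtain ⟨b, rfl⟩ := Ideal.mem_span_singleton'.mp hv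
    rw [mul_add]
    refine Ideal.add_mem _ (Ideal.mem_sup_left ?_) (Ideal.mem_sup_right ?_)
    · rw [show algebraMap _ S t ^ (d + 1) * (a * algebraMap _ S (blowupAlgebra.frac x j'.succ 0)) =
          (a * algebraMap _ S t ^ d) * algebraMap _ S (t * blowupAlgebra.frac x j'.succ 0) by rw [map_mul]; ring, ← h0]
      exact Ideal.mul_mem_left _ _ (Ideal.mem_span_singleton_self _)
    · rw [show algebraMap _ S t ^ (d + 1) * (b * algebraMap _ S (MvPolynomial.aeval (fun l => blowupAlgebra.frac x j'.succ l.succ) Φ)) =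
          (b * algebraMap _ S t) * algebraMap _ S (t ^ d * MvPolynomial.aeval (fun l => blowupAlgebra.frac x j'.succ l.succ) Φ) by
            rw [map_mul, map_pow]; ring, ← hG]
      exact Ideal.mul_mem_left _ _ (Ideal.mem_span_singleton_self _)

end Chart

end Summit.ResolutionOfSingularities.ResolutionOfSingularities.Cruxes.EquisingularLiftNat.Sections

end
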